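import Mathlib
import Summits.NavierStokesRegularity.NavierStokesRegularity.Theorems.SubOnsagerCeilingKPExitSprayStarvation
import HarnessLib

/-!
# ENERGY STARVATION by a spray of dead-end exits of both kinds — mechanism file 2/2: the starved chain fluxes
# (helper file for the crux `SubOnsagerCeiling.ForwardTailCeilingKP`, stmt-NavierStokesRegularity-27057, `--supports`; part 2 of 3)

Sequel of `Theorems/SubOnsagerCeilingKPExitSprayStarvation.lean` (the EXIT-SPRAY class: chain `W 0 > 0` on component `0`,
diagonal leaks `W e ≥ 0` and in-shell pumps `P e ≥ 0` into the dead ends `e ≠ 0`; closed forms and the two-term comparison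
`x_{e,N} ≥ (W e/W 0)x_{0,N} + (P e/W 0)x_{0,N+1}`).  Here:

* `exitSpray_outflux_le_influx` — single-mode energy balance of `x_{0,m+1}` (`m : ℕ`): total drain work (chain + leaks + pumps)
  up to time `t` is at most the chain in-flux `Φ_{m+1}(t) = ∫₀ᵗ Λ_m W₀ x²_{0,m} x_{0,m+1}`;
* `exitSpray_flux_step` — `(1 + r)·Φ_{m+2}(t) ≤ Φ_{m+1}(t)`, `r = (W 1² + W 2² + W 3² + P 1² + P 2² + P 3²)/W 0²`
  (the exits take at least `r` times the onward chain flux at every instant);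
* `exitSpray_flux_le` — `Φ_{m+1}(t) ≤ E₀·q^m`, `q = (1+r)⁻¹` (induction; base from the class-wide flux budget).

HONEST FRAMING: statements about Tao-type MODEL lattice ODEs (route SubOnsagerCeiling, rung TL-M2Break); one architecture
class; no stub, crux or summit is proved and nothing here bears on Navier–Stokes regularity.
[cite: Tao2016AveragedNS, §4 (4.8)–(4.9), (4.13)]
-/

noncomputable section

-- the sub-problem namespace `NavierStokesRegularity.NavierStokesRegularity` is the tree's layout (D-0017)
set_option linter.dupNamespace false

namespace Summit.NavierStokesRegularity.NavierStokesRegularity.Theorems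

open Set Finset MeasureTheory intervalIntegral
open scoped Topology
open Literature.Analysis.FluidPDE.TaoCascade

section ExitSprayFlux

variable {α : Fin 4 → Fin 4 → Fin 4 → ℤ × ℤ × ℤ → ℝ} {W P : Fin 4 → ℝ}
  (hs : IsSymmetricCoeff α) (hc : IsCancellingCoeff α)
  (hO : ∀ (Y : Fin 4 → ℤ → ℝ → ℝ) (τ : ℝ), (∀ (j : Fin 4) (k : ℤ), 1 ≤ k → 0 ≤ Y j k τ) →
    ∀ δ : ℝ, 0 < δ → ∀ (i : Fin 4) (n : ℤ), 1 ≤ n → Y i n τ = 0 → 0 ≤ quadTerm δ α Y i n τ)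
  (hD : ∀ a b i : Fin 4, a ≠ b → α a b i (0, 0, 1) = 0)
  (hW : ∀ a i : Fin 4, α a a i (0, 0, 1) = if a = 0 then W i else 0)
  (hP : ∀ a c : Fin 4, a ≠ c → α a a c (0, 0, 0) = if a = 0 then P c else 0) (hP0 : P 0 = 0)
  (hCz : ∀ a b c : Fin 4, a ≠ b → a ≠ c → b ≠ c → α a b c (0, 0, 0) = 0)
include hs hc hO hD hW hP hP0 hCz

/-- **Single-mode energy balance of the chain mode** at a shell `m+1 ≥ 1`: the total drain work (chain + leaks + pumps) up
to time `t` is at most the chain in-flux: `∫₀ᵗ Λ_{m+1} x²_{0,m+1}(Σ_j W j X_{j,m+2} + Σ_b P b X_{b,m+1}) ≤ ∫₀ᵗ Λ_m W₀ x²_{0,m} x_{0,m+1}`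
(`ν ≥ 0`). [cite: Tao2016AveragedNS, §4 (4.8)–(4.9), (4.13)] -/
theorem exitSpray_outflux_le_influx {ε₀ ν s : ℝ} (hε : 0 ≤ ε₀) (hν : 0 ≤ ν)
    {X₀ : Fin 4 → ℝ} {X : Fin 4 → ℤ → ℝ → ℝ}
    (hdat : ∀ (i : Fin 4) (k : ℤ), X i k 0 = if k = 0 then X₀ i else 0)
    (hXc : ∀ (i : Fin 4) (k : ℤ), Continuous (X i k))
    (hode : ∀ (i : Fin 4) (k : ℤ), ∀ t ∈ Icc (0 : ℝ) s, HasDerivWithinAt (X i k)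
      (quadTerm ε₀ α X i k t - ν * (1 + ε₀) ^ ((2 : ℝ) * k) * X i k t) (Icc (0 : ℝ) s) t) (m : ℕ) :
    ∀ t ∈ Icc (0 : ℝ) s,
      ∫ τ in (0 : ℝ)..t, (1 + ε₀) ^ ((5 : ℝ) * ((m : ℝ) + 1) / 2) *
          (X 0 ((m : ℤ) + 1) τ ^ 2 * (∑ j, W j * X j ((m : ℤ) + 2) τ + ∑ b, P b * X b ((m : ℤ) + 1) τ)) ≤
        ∫ τ in (0 : ℝ)..t, (1 + ε₀) ^ ((5 : ℝ) * (m : ℝ) / 2) * (W 0 * X 0 (m : ℤ) τ ^ 2 * X 0 ((m : ℤ) + 1) τ) := by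
  have hb : (0 : ℝ) < 1 + ε₀ := by linarith
  set Λm : ℝ := (1 + ε₀) ^ ((5 : ℝ) * (m : ℝ) / 2) with hΛm
  set Λn : ℝ := (1 + ε₀) ^ ((5 : ℝ) * ((m : ℝ) + 1) / 2) with hΛn
  set κ : ℝ := ν * (1 + ε₀) ^ ((2 : ℝ) * ((m : ℝ) + 1)) with hκ
  have hκ0 : 0 ≤ κ := by positivity
  set x : ℝ → ℝ := fun τ => X 0 ((m : ℤ) + 1) τ with hx
  set xm : ℝ → ℝ := fun τ => X 0 (m : ℤ) τ with hxm
  set D : ℝ → ℝ := fun τ => ∑ j, W j * X j ((m : ℤ) + 2) τ + ∑ b, P b * X b ((m : ℤ) + 1) τ with hDsum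
  have hxc : Continuous x := hXc 0 _
  have hxmc : Continuous xm := hXc 0 _
  have hDc : Continuous D := (continuous_finsetSum _ fun j _ => continuous_const.mul (hXc j _)).add
    (continuous_finsetSum _ fun j _ => continuous_const.mul (hXc j _))
  have hxd : ∀ τ ∈ Icc (0 : ℝ) s, HasDerivWithinAt x
      (W 0 * Λm * xm τ ^ 2 - Λn * (x τ * D τ) - κ * x τ) (Icc 0 s) τ := by
    intro τ hτ
    have h0 := hode 0 ((m : ℤ) + 1) τ hτ
    rw [exitSpray_quadTerm_chain hs hc hO hD hW hP hP0 hCz] at h0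
    have hidx : ((m : ℤ) + 1 - 1) = (m : ℤ) := by omega
    have hidx2 : ((m : ℤ) + 1 + 1) = (m : ℤ) + 2 := by ring
    have he1 : ((5 : ℝ) * ((((m : ℤ) + 1 : ℤ) : ℝ) - 1) / 2) = (5 : ℝ) * (m : ℝ) / 2 := by push_cast; ring
    have he2 : ((5 : ℝ) * (((m : ℤ) + 1 : ℤ) : ℝ) / 2) = (5 : ℝ) * ((m : ℝ) + 1) / 2 := by push_cast; ring
    have he3 : ((2 : ℝ) * (((m : ℤ) + 1 : ℤ) : ℝ)) = (2 : ℝ) * ((m : ℝ) + 1) := by push_cast; ring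
    rw [hidx, hidx2, he1, he2, he3] at h0
    refine h0.congr_deriv ?_
    simp only [hΛm, hΛn, hκ, hx, hxm, hDsum]
  set IN : ℝ → ℝ := fun τ => Λm * (W 0 * xm τ ^ 2 * x τ) with hIN
  set OUT : ℝ → ℝ := fun τ => Λn * (x τ ^ 2 * D τ) with hOUT
  set VISC : ℝ → ℝ := fun τ => κ * x τ ^ 2 with hVISC
  have hINc : Continuous IN := continuous_const.mul ((continuous_const.mul (hxmc.pow 2)).mul hxc)
  have hOUTc : Continuous OUT := continuous_const.mul ((hxc.pow 2).mul hDc)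
  have hVISCc : Continuous VISC := continuous_const.mul (hxc.pow 2)
  set G : ℝ → ℝ := fun τ => (1 / 2 : ℝ) * x τ ^ 2 - (∫ u in (0 : ℝ)..τ, IN u) + (∫ u in (0 : ℝ)..τ, OUT u) +
    ∫ u in (0 : ℝ)..τ, VISC u with hG
  have hprim : ∀ {f : ℝ → ℝ}, Continuous f → ∀ τ : ℝ,
      HasDerivWithinAt (fun u => ∫ v in (0 : ℝ)..u, f v) (f τ) (Icc 0 s) τ := by
    intro f hf τ
    exact (intervalIntegral.integral_hasDerivAt_right (hf.intervalIntegrable _ _)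
      (hf.stronglyMeasurableAtFilter _ _) hf.continuousAt).hasDerivWithinAt
  have hGd : ∀ τ ∈ Icc (0 : ℝ) s, HasDerivWithinAt G 0 (Icc 0 s) τ := by
    intro τ hτ
    have he : HasDerivWithinAt (fun u => (1 / 2 : ℝ) * x u ^ 2)
        ((1 / 2 : ℝ) * (((2 : ℕ) : ℝ) * x τ ^ (2 - 1) *
          (W 0 * Λm * xm τ ^ 2 - Λn * (x τ * D τ) - κ * x τ))) (Icc 0 s) τ :=
      ((hxd τ hτ).pow 2).const_mul (1 / 2)
    have h := ((he.sub (hprim hINc τ)).add (hprim hOUTc τ)).add (hprim hVISCc τ)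
    refine h.congr_deriv ?_
    simp only [hIN, hOUT, hVISC]
    push_cast
    ring
  have hGc : ContinuousOn G (Icc 0 s) := fun τ hτ => (hGd τ hτ).continuousWithinAt
  have hGd' : ∀ u ∈ Ico (0 : ℝ) s, HasDerivWithinAt G 0 (Ici u) u := fun u hu =>
    (hGd u (Ico_subset_Icc_self hu)).mono_of_mem_nhdsWithin
      (Filter.mem_of_superset (Icc_mem_nhdsGE hu.2) (Icc_subset_Icc hu.1 le_rfl))
  have hG0 : G 0 = 0 := by
    have : x 0 = 0 := by simp only [hx]; rw [hdat]; simp; omega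
    simp [hG, this]
  intro t ht
  have hGt : G t = 0 := by
    have h := constant_of_has_deriv_right_zero hGc hGd' t ht
    rw [hG0] at h
    exact h
  have hV : 0 ≤ ∫ u in (0 : ℝ)..t, VISC u :=
    intervalIntegral.integral_nonneg ht.1 fun u _ => mul_nonneg hκ0 (sq_nonneg _)
  have hE : 0 ≤ (1 / 2 : ℝ) * x t ^ 2 := by positivity
  have key : (∫ u in (0 : ℝ)..t, OUT u) ≤ ∫ u in (0 : ℝ)..t, IN u := by
    simp only [hG] at hGt
    linarith
  simpa only [hOUT, hIN, hx, hxm, hDsum] using key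

/-- **Geometric starvation of the chain fluxes** (one step): for every `m : ℕ` and `t ∈ [0,s]`,
`(1 + r)·Φ_{m+2}(t) ≤ Φ_{m+1}(t)` with `r = (W 1² + W 2² + W 3² + P 1² + P 2² + P 3²)/W 0²`
(`Φ_{k+1}(t) = ∫₀ᵗ Λ_k W₀ x²_{0,k} x_{0,k+1}`; the exits take at least `r` times the onward chain flux at every instant, by
`exitSpray_pocket_ge`). [cite: Tao2016AveragedNS, §4 (4.8)–(4.9), (4.13)] -/
theorem exitSpray_flux_step {ε₀ ν s : ℝ} (hε : 0 ≤ ε₀) (hν : 0 ≤ ν) (hW0 : 0 < W 0) (hWnn : ∀ i, 0 ≤ W i)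
    (hPnn : ∀ i, 0 ≤ P i) {X₀ : Fin 4 → ℝ} {X : Fin 4 → ℤ → ℝ → ℝ}
    (hdat : ∀ (i : Fin 4) (k : ℤ), X i k 0 = if k = 0 then X₀ i else 0)
    (hXc : ∀ (i : Fin 4) (k : ℤ), Continuous (X i k))
    (hode : ∀ (i : Fin 4) (k : ℤ), ∀ t ∈ Icc (0 : ℝ) s, HasDerivWithinAt (X i k)
      (quadTerm ε₀ α X i k t - ν * (1 + ε₀) ^ ((2 : ℝ) * k) * X i k t) (Icc (0 : ℝ) s) t)
    (hnn : ∀ t ∈ Icc (0 : ℝ) s, ∀ (i : Fin 4) (k : ℤ), 1 ≤ k → 0 ≤ X i k t) (m : ℕ) :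
    ∀ t ∈ Icc (0 : ℝ) s,
      (1 + (W 1 ^ 2 + W 2 ^ 2 + W 3 ^ 2 + P 1 ^ 2 + P 2 ^ 2 + P 3 ^ 2) / W 0 ^ 2) *
          ∫ τ in (0 : ℝ)..t, (1 + ε₀) ^ ((5 : ℝ) * ((m : ℝ) + 1) / 2) *
            (W 0 * X 0 ((m : ℤ) + 1) τ ^ 2 * X 0 ((m : ℤ) + 2) τ) ≤
        ∫ τ in (0 : ℝ)..t, (1 + ε₀) ^ ((5 : ℝ) * (m : ℝ) / 2) * (W 0 * X 0 (m : ℤ) τ ^ 2 * X 0 ((m : ℤ) + 1) τ) := by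
  intro t ht
  have hb : (0 : ℝ) < 1 + ε₀ := by linarith
  have hout := exitSpray_outflux_le_influx hs hc hO hD hW hP hP0 hCz hε hν hdat hXc hode m t ht
  set Λn : ℝ := (1 + ε₀) ^ ((5 : ℝ) * ((m : ℝ) + 1) / 2) with hΛn
  have hΛn0 : 0 ≤ Λn := by positivity
  set r : ℝ := (W 1 ^ 2 + W 2 ^ 2 + W 3 ^ 2 + P 1 ^ 2 + P 2 ^ 2 + P 3 ^ 2) / W 0 ^ 2 with hr
  -- pointwise: total drain ≥ (1+r)·chain drain
  have hpt : ∀ τ ∈ Icc (0 : ℝ) t,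
      (1 + r) * (Λn * (W 0 * X 0 ((m : ℤ) + 1) τ ^ 2 * X 0 ((m : ℤ) + 2) τ)) ≤
        Λn * (X 0 ((m : ℤ) + 1) τ ^ 2 *
          (∑ j, W j * X j ((m : ℤ) + 2) τ + ∑ b, P b * X b ((m : ℤ) + 1) τ)) := by
    intro τ hτ
    have hτs : τ ∈ Icc (0 : ℝ) s := ⟨hτ.1, hτ.2.trans ht.2⟩
    -- leaks at shell m+2, pumps at shell m+1, both compared with x_{0,m+2}
    have hgeW : ∀ e : Fin 4, e ≠ 0 → W e / W 0 * X 0 ((m : ℤ) + 2) τ ≤ X e ((m : ℤ) + 2) τ := by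
      intro e he
      have h := exitSpray_pocket_ge hs hc hO hD hW hP hP0 hCz hε hν hW0 hWnn hPnn hdat hode hnn he
        (N := (m : ℤ) + 2) (by omega) τ hτs
      have h' : 0 ≤ P e / W 0 * X 0 ((m : ℤ) + 2 + 1) τ :=
        mul_nonneg (div_nonneg (hPnn e) hW0.le) (hnn τ hτs 0 _ (by omega))
      linarith
    have hgeP : ∀ e : Fin 4, e ≠ 0 → P e / W 0 * X 0 ((m : ℤ) + 2) τ ≤ X e ((m : ℤ) + 1) τ := by
      intro e he
      have h := exitSpray_pocket_ge hs hc hO hD hW hP hP0 hCz hε hν hW0 hWnn hPnn hdat hode hnn he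
        (N := (m : ℤ) + 1) (by omega) τ hτs
      have h' : 0 ≤ W e / W 0 * X 0 ((m : ℤ) + 1) τ :=
        mul_nonneg (div_nonneg (hWnn e) hW0.le) (hnn τ hτs 0 _ (by omega))
      rw [show ((m : ℤ) + 1 + 1) = (m : ℤ) + 2 by ring] at h
      linarith
    have h1 := mul_le_mul_of_nonneg_left (hgeW 1 (by decide)) (hWnn 1)
    have h2 := mul_le_mul_of_nonneg_left (hgeW 2 (by decide)) (hWnn 2)
    have h3 := mul_le_mul_of_nonneg_left (hgeW 3 (by decide)) (hWnn 3)
    have h4 := mul_le_mul_of_nonneg_left (hgeP 1 (by decide)) (hPnn 1)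
    have h5 := mul_le_mul_of_nonneg_left (hgeP 2 (by decide)) (hPnn 2)
    have h6 := mul_le_mul_of_nonneg_left (hgeP 3 (by decide)) (hPnn 3)
    have hsum : (1 + r) * (W 0 * X 0 ((m : ℤ) + 2) τ) ≤
        ∑ j, W j * X j ((m : ℤ) + 2) τ + ∑ b, P b * X b ((m : ℤ) + 1) τ := by
      rw [Fin.sum_univ_four, Fin.sum_univ_four, hP0]
      have hid : (1 + r) * (W 0 * X 0 ((m : ℤ) + 2) τ) =
          W 0 * X 0 ((m : ℤ) + 2) τ + W 1 * (W 1 / W 0 * X 0 ((m : ℤ) + 2) τ) +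
            W 2 * (W 2 / W 0 * X 0 ((m : ℤ) + 2) τ) + W 3 * (W 3 / W 0 * X 0 ((m : ℤ) + 2) τ) +
            (P 1 * (P 1 / W 0 * X 0 ((m : ℤ) + 2) τ) + P 2 * (P 2 / W 0 * X 0 ((m : ℤ) + 2) τ) +
              P 3 * (P 3 / W 0 * X 0 ((m : ℤ) + 2) τ)) := by
        simp only [hr]
        field_simp
        ring
      rw [hid]
      have : (0 : Fin 4) = 0 := rfl
      linarith
    have hfac : 0 ≤ Λn * X 0 ((m : ℤ) + 1) τ ^ 2 := by positivity
    have := mul_le_mul_of_nonneg_left hsum hfac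
    have hl : (1 + r) * (Λn * (W 0 * X 0 ((m : ℤ) + 1) τ ^ 2 * X 0 ((m : ℤ) + 2) τ)) =
        Λn * X 0 ((m : ℤ) + 1) τ ^ 2 * ((1 + r) * (W 0 * X 0 ((m : ℤ) + 2) τ)) := by ring
    have hr' : Λn * (X 0 ((m : ℤ) + 1) τ ^ 2 *
        (∑ j, W j * X j ((m : ℤ) + 2) τ + ∑ b, P b * X b ((m : ℤ) + 1) τ)) =
        Λn * X 0 ((m : ℤ) + 1) τ ^ 2 * (∑ j, W j * X j ((m : ℤ) + 2) τ + ∑ b, P b * X b ((m : ℤ) + 1) τ) := by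
      ring
    rw [hl, hr']
    exact this
  have hc1 : Continuous fun τ => Λn * (W 0 * X 0 ((m : ℤ) + 1) τ ^ 2 * X 0 ((m : ℤ) + 2) τ) :=
    continuous_const.mul ((continuous_const.mul ((hXc 0 _).pow 2)).mul (hXc 0 _))
  have hc2 : Continuous fun τ => Λn * (X 0 ((m : ℤ) + 1) τ ^ 2 *
      (∑ j, W j * X j ((m : ℤ) + 2) τ + ∑ b, P b * X b ((m : ℤ) + 1) τ)) :=
    continuous_const.mul (((hXc 0 _).pow 2).mul
      ((continuous_finsetSum _ fun j _ => continuous_const.mul (hXc j _)).add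
        (continuous_finsetSum _ fun j _ => continuous_const.mul (hXc j _))))
  have hmono : (1 + r) * (∫ τ in (0 : ℝ)..t, Λn * (W 0 * X 0 ((m : ℤ) + 1) τ ^ 2 * X 0 ((m : ℤ) + 2) τ)) ≤
      ∫ τ in (0 : ℝ)..t, Λn * (X 0 ((m : ℤ) + 1) τ ^ 2 *
        (∑ j, W j * X j ((m : ℤ) + 2) τ + ∑ b, P b * X b ((m : ℤ) + 1) τ)) := by
    rw [← intervalIntegral.integral_const_mul]
    exact intervalIntegral.integral_mono_on ht.1 ((hc1.const_mul _).intervalIntegrable _ _)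
      (hc2.intervalIntegrable _ _) hpt
  exact hmono.trans hout

/-- **Geometric starvation of the chain fluxes**: `Φ_{m+1}(t) ≤ E₀·q^m`, `q = (1 + r)⁻¹`, for every bond `m → m+1` and
`t ∈ [0,s]` (induction; base: the chain flux through `0 → 1` is part of the non-negative gate flux, `≤ E₀` by
`kpProper_bondFlux_budget`). [cite: Tao2016AveragedNS, §4 (4.8)–(4.9), (4.13)] -/
theorem exitSpray_flux_le {ε₀ ν s : ℝ} (hε : 0 ≤ ε₀) (hν : 0 ≤ ν) (hW0 : 0 < W 0) (hWnn : ∀ i, 0 ≤ W i)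
    (hPnn : ∀ i, 0 ≤ P i) {X₀ : Fin 4 → ℝ} {X : Fin 4 → ℤ → ℝ → ℝ}
    (hdat : ∀ (i : Fin 4) (k : ℤ), X i k 0 = if k = 0 then X₀ i else 0)
    (hvan : ∀ (i : Fin 4) (k : ℤ), k < 0 → ∀ t : ℝ, X i k t = 0)
    (hXc : ∀ (i : Fin 4) (k : ℤ), Continuous (X i k))
    (hode : ∀ (i : Fin 4) (k : ℤ), ∀ t ∈ Icc (0 : ℝ) s, HasDerivWithinAt (X i k)
      (quadTerm ε₀ α X i k t - ν * (1 + ε₀) ^ ((2 : ℝ) * k) * X i k t) (Icc (0 : ℝ) s) t)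
    (hnn : ∀ t ∈ Icc (0 : ℝ) s, ∀ (i : Fin 4) (k : ℤ), 1 ≤ k → 0 ≤ X i k t) :
    ∀ m : ℕ, ∀ t ∈ Icc (0 : ℝ) s,
      ∫ τ in (0 : ℝ)..t, (1 + ε₀) ^ ((5 : ℝ) * (m : ℝ) / 2) * (W 0 * X 0 (m : ℤ) τ ^ 2 * X 0 ((m : ℤ) + 1) τ) ≤
        (∑ i, (1 / 2 : ℝ) * X₀ i ^ 2) *
          ((1 + (W 1 ^ 2 + W 2 ^ 2 + W 3 ^ 2 + P 1 ^ 2 + P 2 ^ 2 + P 3 ^ 2) / W 0 ^ 2)⁻¹) ^ m := by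
  have hr : 0 < 1 + (W 1 ^ 2 + W 2 ^ 2 + W 3 ^ 2 + P 1 ^ 2 + P 2 ^ 2 + P 3 ^ 2) / W 0 ^ 2 := by positivity
  have hb : (0 : ℝ) < 1 + ε₀ := by linarith
  intro m
  induction m with
  | zero =>
    intro t ht
    have h := kpProper_bondFlux_budget hs hc hO hD hb hν hdat hvan hXc hode 0 t ht
    simp only [leakSpray_gateFlux hW] at h
    have hc1 : Continuous fun τ => (1 + ε₀) ^ ((5 : ℝ) * ((0 : ℕ) : ℝ) / 2) *
        (W 0 * X 0 ((0 : ℕ) : ℤ) τ ^ 2 * X 0 (((0 : ℕ) : ℤ) + 1) τ) :=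
      continuous_const.mul ((continuous_const.mul ((hXc 0 _).pow 2)).mul (hXc 0 _))
    have hc2 : Continuous fun τ => (1 + ε₀) ^ ((5 : ℝ) * ((0 : ℕ) : ℝ) / 2) *
        (X 0 ((0 : ℕ) : ℤ) τ ^ 2 * ∑ j, W j * X j (((0 : ℕ) : ℤ) + 1) τ) :=
      continuous_const.mul (((hXc 0 _).pow 2).mul (continuous_finsetSum _ fun j _ => continuous_const.mul (hXc j _)))
    have hle : ∫ τ in (0 : ℝ)..t, (1 + ε₀) ^ ((5 : ℝ) * ((0 : ℕ) : ℝ) / 2) *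
          (W 0 * X 0 ((0 : ℕ) : ℤ) τ ^ 2 * X 0 (((0 : ℕ) : ℤ) + 1) τ) ≤
        ∫ τ in (0 : ℝ)..t, (1 + ε₀) ^ ((5 : ℝ) * ((0 : ℕ) : ℝ) / 2) *
          (X 0 ((0 : ℕ) : ℤ) τ ^ 2 * ∑ j, W j * X j (((0 : ℕ) : ℤ) + 1) τ) := by
      refine intervalIntegral.integral_mono_on ht.1 (hc1.intervalIntegrable _ _) (hc2.intervalIntegrable _ _)
        fun τ hτ => ?_
      have hτs : τ ∈ Icc (0 : ℝ) s := ⟨hτ.1, hτ.2.trans ht.2⟩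
      have hΛ : 0 ≤ (1 + ε₀) ^ ((5 : ℝ) * ((0 : ℕ) : ℝ) / 2) := by positivity
      refine mul_le_mul_of_nonneg_left ?_ hΛ
      rw [Fin.sum_univ_four]
      have h1 : 0 ≤ W 1 * X 1 (((0 : ℕ) : ℤ) + 1) τ := mul_nonneg (hWnn 1) (hnn τ hτs 1 _ (by simp))
      have h2 : 0 ≤ W 2 * X 2 (((0 : ℕ) : ℤ) + 1) τ := mul_nonneg (hWnn 2) (hnn τ hτs 2 _ (by simp))
      have h3 : 0 ≤ W 3 * X 3 (((0 : ℕ) : ℤ) + 1) τ := mul_nonneg (hWnn 3) (hnn τ hτs 3 _ (by simp))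
      nlinarith [sq_nonneg (X 0 ((0 : ℕ) : ℤ) τ)]
    rw [pow_zero, mul_one]
    exact hle.trans h
  | succ m ih =>
    intro t ht
    have hstep := exitSpray_flux_step hs hc hO hD hW hP hP0 hCz hε hν hW0 hWnn hPnn hdat hXc hode hnn m t ht
    have hih := ih t ht
    have hcast1 : (((m + 1 : ℕ) : ℝ)) = (m : ℝ) + 1 := by push_cast; ring
    have hcast2 : (((m + 1 : ℕ) : ℤ)) = (m : ℤ) + 1 := by push_cast; ring
    have hcast3 : ((m : ℤ) + 1 + 1) = (m : ℤ) + 2 := by ring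
    rw [hcast1, hcast2, hcast3, pow_succ]
    have h2 : ∫ τ in (0 : ℝ)..t, (1 + ε₀) ^ ((5 : ℝ) * ((m : ℝ) + 1) / 2) *
        (W 0 * X 0 ((m : ℤ) + 1) τ ^ 2 * X 0 ((m : ℤ) + 2) τ) ≤
        (∫ τ in (0 : ℝ)..t, (1 + ε₀) ^ ((5 : ℝ) * (m : ℝ) / 2) *
          (W 0 * X 0 (m : ℤ) τ ^ 2 * X 0 ((m : ℤ) + 1) τ)) *
          (1 + (W 1 ^ 2 + W 2 ^ 2 + W 3 ^ 2 + P 1 ^ 2 + P 2 ^ 2 + P 3 ^ 2) / W 0 ^ 2)⁻¹ := by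
      rw [le_mul_inv_iff₀ hr, mul_comm]
      exact hstep
    calc _ ≤ _ := h2
      _ ≤ (∑ i, (1 / 2 : ℝ) * X₀ i ^ 2) *
            ((1 + (W 1 ^ 2 + W 2 ^ 2 + W 3 ^ 2 + P 1 ^ 2 + P 2 ^ 2 + P 3 ^ 2) / W 0 ^ 2)⁻¹) ^ m *
            (1 + (W 1 ^ 2 + W 2 ^ 2 + W 3 ^ 2 + P 1 ^ 2 + P 2 ^ 2 + P 3 ^ 2) / W 0 ^ 2)⁻¹ :=
          mul_le_mul_of_nonneg_right hih (inv_nonneg.2 hr.le)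
      _ = _ := by ring

end ExitSprayFlux

end Summit.NavierStokesRegularity.NavierStokesRegularity.Theorems

end
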